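import Summits.BirchSwinnertonDyer.Rank1Residual.Additive.XGssRankZeroCyclotomicThreeFacts
import HarnessLib

/-!
# X4 at `p = 3`, CLASS LEVEL, ranks `(0,0)`: the irreducible additive pairs `(W, 3)` with
# `surj(3) ∧ ram(3)` whose twist `V = W^{(−3)}` is good SUPERSINGULAR at `3` with `a₃(V) = 0` (line V18)

HONEST FRAMING (cell `b2b-bsdres`, run/shared/lean/b2b/bsd-rank1-residual/, verbatim in every
file): the goal of the cell is to DELETE the COMBINATION-SHAPED residual classes of the
Birch–Swinnerton-Dyer formula for ALL analytic-rank `≤ 1` elliptic curves over `ℚ` — "full BSD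
formula for every rank `≤ 1` curve in class `C`" assembled STRICTLY from published theorems — so
that the rank-`≤ 1` remainder becomes exactly the CONSTRUCTION-SHAPED classes, which are TYPED
(missing-input `Prop`s), NOT attempted. This is not "finishing BSD". Seat additive-p4 (research route
on the construction-shaped classes X3/X4), gen 8; the X4 label is UNCHANGED by this file; nothing is
booked here (the referee rules on bookings).

Theorems only (no `def`, no `sorry`, no new named fact). The supersingular companion of
`X4SemistableTwistRankZeroThreeClass.lean` (gen 7: twist ORDINARY-SEMISTABLE at `3`, lines
V14b/V15/V16): line V18 (`XGssRankZeroCyclotomicThree{,Facts}.lean`) reaches the X4 pairs at `p = 3`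
whose twist `V` is GOOD SUPERSINGULAR with `a₃(V) = 0` — a good twist of an X4 curve can be
supersingular (130 census rows; for X3 it cannot: `E[3]` reducible + good at `3` ⇒ ordinary) — from
Kobayashi 2003 Thm. 4.1 (plus Selmer group, both tame characters, over `ℚ(ζ₃)`), Kitajima–Otsuki
2018 Main Thm. 1.3, Pollack 2003, Milne 1972, modularity and Gross–Zagier–Kolyvagin, with the
CONTROL INEQUALITY in place of an (unprinted) exact Euler characteristic; the price is the per-row
datum `3 ∤ ∏_w c_w(V_K)`, `K = ℚ(ζ₃)` (equal to `3 ∤ ∏c(V)·∏c(W)` on all 18 census rows, PARI job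
j101244). Stated ONCE on the cell's EXACT class predicate `ClassX4 W 3 = (3 ≠ 2) ∧ Addv W 3 ∧ Irr W 3`
(`Literature/…/Rank1Residual/Predicates.lean`) for the partition table:

* `ClassX4.exists_padicVal_shaOrder_add_le_three_of_ssTwist` — the sum inequality
  `ord₃#Ш(V) + ord₃#Ш(W) + 2 ord₃#V(K) ≤ ord₃#Ш_an(V) + ord₃#Ш_an(W) + ord₃ ∏_w c_w(V_K)`;
* `ClassX4.missingUpperBoundAt_three_of_ssTwist` — `3 ∤ #Ш_an(V)·∏_w c_w(V_K)` ⇒ `Typed.MissingUpperBoundAt W 3`;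
* `ClassX4.bsdp_three_of_ssTwist_of_shaAn_units` — unit rows ⇒ **`BSD(W,3) ∧ BSD(V,3)`**.

The `a₃(V) = ±3` twists (41 rank-`(0,0)` census rows) are NOT covered (Kobayashi / Kitajima–Otsuki
need `a_p = 0`; Sprung's `♯/♭` theory is printed over `ℚ_∞` with a layer-`∞` local condition only).

Census (hyp two-engine table `b2b-bsdres-hyp/hyp/cyc3/cyc3_two_engine.tsv` × PARI job j101244,
`N < 2·10⁴`; HOME/b2b-bsdres-additive-p4/V18-CENSUS.tsv): 18 CORE-open rank-`(0,0)` rows with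
`a₃(V) = 0`, all doubly-unit and `surj(3)`; **11 reach `BSD₃(W) ∧ BSD₃(V)`** (ram prime, `3 ∤ ∏_w c_w(V_K)`),
5 only the inequality (`3 ∣ ∏_w c_w(V_K)`), 2 lack a (ram) prime.
-/

noncomputable section

open scoped Classical MatrixGroups ModularForm

open CongruenceSubgroup WeierstrassCurve Literature.NumberTheory.EllipticCurves
  Literature.NumberTheory.EllipticCurves.ModularForms
  Literature.NumberTheory.EllipticCurves.Rank1Residual
  Literature.NumberTheory.EllipticCurves.Rank1Residual.Typed
  Literature.NumberTheory.EllipticCurves.Kobayashi2003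

namespace Summit.BirchSwinnertonDyer.Rank1Residual.Additive

variable (V : WeierstrassCurve ℚ) [V.IsElliptic] [V.IsGloballyMinimal]
  (W : WeierstrassCurve ℚ) [W.IsElliptic] [W.IsGloballyMinimal]

/-- **X4 at `p = 3`, class level, ranks `(0,0)`, SUPERSINGULAR twist: the sum inequality.** Let
`(W, 3)` be an X4 pair (`ClassX4 W 3`) with census bits `surj(3)` and `ram(3)`, and `V` a globally
minimal curve with `C • V^{(−3)} = W`, GOOD at `3` with `a₃(V) = 0`, both of analytic rank `0`. Then
`#Ш_an(V) = q_V`, `#Ш_an(W) = q_W` are rationals with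
**`ord₃ #Ш(V) + ord₃ #Ш(W) + 2 ord₃ #V(K) ≤ ord₃ q_V + ord₃ q_W + ord₃ ∏_w c_w(V_K)`**,
`K = ℚ(ζ₃)` (`CyclotomicField 3 ℚ`), granted the named published facts of line V18: Kobayashi 2003
Thm. 4.1 (+, both `η`) / 2.2 / 3.2 over `ℚ(ζ₃)` (`hKob`), Kitajima–Otsuki 2018 Main Thm. 1.3 (`hKO`),
Pollack 2003 (`hPol`), Milne 1972 (`hMilne`), modularity (`hmod`, `hmodD`), GZK (`hGZK`).
[cite: Kobayashi2003, Thm. 4.1 (p. 8)] [cite: KitajimaOtsuki2018, Main Thm. 1.3]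
[cite: Milne1972ArithmeticAV, §1 Thm. 1] -/
theorem ClassX4.exists_padicVal_shaOrder_add_le_three_of_ssTwist
    (hKob : Kobayashi2003.thm41_plusCharIdeal_dvd_cyclotomicThree)
    (hKO : KitajimaOtsuki2018.mainThm13_plusSelmerDual_noFiniteSubmodule)
    (hPol : ∀ {N : ℕ} [NeZero N] (f : CuspForm (Gamma0 N) 2),
      pollack_exists_plusMinusPAdicLFunction (W := V) (f := f) (p := 3))
    (hMilne : Milne1972.bsdQuotient_baseChange_quadratic_anyModel)
    (hGZK : rank_eq_analyticRank_of_analyticRank_le_one) (hmod : hasEntireLFunction_rat)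
    (hmodD : nonempty_modularParametrizationData)
    (hX : ClassX4 W 3) (hsurj : Surj W 3) (hram : Ram W 3)
    (C : VariableChange ℚ) (hC : C • V.quadraticTwist (-(3 : ℚ)) = W)
    (hgood : V.HasGoodReductionAtPrime 3) (ha3 : V.frobeniusTrace 3 = 0)
    (hrV : V.analyticRank = 0) (hrW : W.analyticRank = 0) :
    ∃ qV qW : ℚ, shaAn V = (qV : ℂ) ∧ shaAn W = (qW : ℂ) ∧
      (padicValNat 3 V.shaOrder : ℤ) + padicValNat 3 W.shaOrder +
          2 * padicValNat 3 (Nat.card (V.baseChange (CyclotomicField 3 ℚ)).toAffine.Point) ≤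
        padicValRat 3 qV + padicValRat 3 qW +
          padicValNat 3 (V.baseChange (CyclotomicField 3 ℚ)).tamagawaProduct :=
  XGssCyclotomicThree.exists_padicVal_shaOrder_add_le_of_facts_of_surj_of_ram V W hKob hKO hPol hMilne
    hGZK hmod hmodD C hC hgood ha3 hsurj hram hX.2.1 hrV hrW

/-- **X4 at `p = 3`, class level, supersingular twist: the cell's typed UPPER half for the additive
curve.** In the situation of `ClassX4.exists_padicVal_shaOrder_add_le_three_of_ssTwist`, if
`3 ∤ #Ш_an(V)` and `3 ∤ ∏_w c_w(V_K)` (`K = ℚ(ζ₃)`) then `Typed.MissingUpperBoundAt W 3`.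
[cite: Kobayashi2003, Thm. 4.1 (p. 8)] [cite: KitajimaOtsuki2018, Main Thm. 1.3] -/
theorem ClassX4.missingUpperBoundAt_three_of_ssTwist
    (hKob : Kobayashi2003.thm41_plusCharIdeal_dvd_cyclotomicThree)
    (hKO : KitajimaOtsuki2018.mainThm13_plusSelmerDual_noFiniteSubmodule)
    (hPol : ∀ {N : ℕ} [NeZero N] (f : CuspForm (Gamma0 N) 2),
      pollack_exists_plusMinusPAdicLFunction (W := V) (f := f) (p := 3))
    (hMilne : Milne1972.bsdQuotient_baseChange_quadratic_anyModel)
    (hGZK : rank_eq_analyticRank_of_analyticRank_le_one) (hmod : hasEntireLFunction_rat)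
    (hmodD : nonempty_modularParametrizationData)
    (hX : ClassX4 W 3) (hsurj : Surj W 3) (hram : Ram W 3)
    (C : VariableChange ℚ) (hC : C • V.quadraticTwist (-(3 : ℚ)) = W)
    (hgood : V.HasGoodReductionAtPrime 3) (ha3 : V.frobeniusTrace 3 = 0)
    (hrV : V.analyticRank = 0) (hrW : W.analyticRank = 0)
    {qV : ℚ} (hqV : shaAn V = (qV : ℂ)) (hv : padicValRat 3 qV ≤ 0)
    (htam : padicValNat 3 (V.baseChange (CyclotomicField 3 ℚ)).tamagawaProduct = 0) :
    MissingUpperBoundAt W 3 :=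
  XGssCyclotomicThree.missingUpperBoundAt_of_surj_of_ram V W hKob hKO hPol hMilne hGZK hmod hmodD C hC
    hgood ha3 hsurj hram hX.2.1 hrV hrW hqV hv htam

/-- **X4 at `p = 3`, class level, supersingular twist: `BSD(W,3) ∧ BSD(V,3)` on the unit rank-`(0,0)`
rows.** In the situation of `ClassX4.exists_padicVal_shaOrder_add_le_three_of_ssTwist`, if `#Ш_an(V)`,
`#Ш_an(W)` are `3`-adic units and `3 ∤ ∏_w c_w(V_K)` (`K = ℚ(ζ₃)`), then Miller's `BSD(W,3)` (the
ADDITIVE X4 pair, potentially supersingular, Kodaira type `I₀*` at `3`) and `BSD(V,3)` (its good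
supersingular big-image twist) hold simultaneously. Census: 11 of the 18 CORE-open rows. Labels
UNCHANGED; nothing booked by this theorem.
[cite: Kobayashi2003, Thm. 4.1 (p. 8)] [cite: KitajimaOtsuki2018, Main Thm. 1.3]
[cite: Milne1972ArithmeticAV, §1 Thm. 1] [cite: Miller2011LMS, §1 and Def. 1.1] -/
theorem ClassX4.bsdp_three_of_ssTwist_of_shaAn_units
    (hKob : Kobayashi2003.thm41_plusCharIdeal_dvd_cyclotomicThree)
    (hKO : KitajimaOtsuki2018.mainThm13_plusSelmerDual_noFiniteSubmodule)
    (hPol : ∀ {N : ℕ} [NeZero N] (f : CuspForm (Gamma0 N) 2),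
      pollack_exists_plusMinusPAdicLFunction (W := V) (f := f) (p := 3))
    (hMilne : Milne1972.bsdQuotient_baseChange_quadratic_anyModel)
    (hGZK : rank_eq_analyticRank_of_analyticRank_le_one) (hmod : hasEntireLFunction_rat)
    (hmodD : nonempty_modularParametrizationData)
    (hX : ClassX4 W 3) (hsurj : Surj W 3) (hram : Ram W 3)
    (C : VariableChange ℚ) (hC : C • V.quadraticTwist (-(3 : ℚ)) = W)
    (hgood : V.HasGoodReductionAtPrime 3) (ha3 : V.frobeniusTrace 3 = 0)
    (hrV : V.analyticRank = 0) (hrW : W.analyticRank = 0)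
    {qV qW : ℚ} (hqV : shaAn V = (qV : ℂ)) (hqW : shaAn W = (qW : ℂ))
    (hvV : padicValRat 3 qV = 0) (hvW : padicValRat 3 qW = 0)
    (htam : padicValNat 3 (V.baseChange (CyclotomicField 3 ℚ)).tamagawaProduct = 0) :
    BSDp W 3 ∧ BSDp V 3 :=
  XGssCyclotomicThree.bsdp_of_shaAn_units_of_surj_of_ram V W hKob hKO hPol hMilne hGZK hmod hmodD C hC
    hgood ha3 hsurj hram hX.2.1 hrV hrW hqV hqW hvV hvW htam

end Summit.BirchSwinnertonDyer.Rank1Residual.Additive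

end
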